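import Summits.BirchSwinnertonDyer.Rank1Residual.Supersingular.IntModelMinimalityKrausTwoMore
import Summits.BirchSwinnertonDyer.BirchSwinnertonDyer.Theorems.Rank1ResidualIntModelReduction
import HarnessLib

/-!
# Route `ErratumRoadFive` (rung K2), crux `RamNoErratumDataAtFive` (item stmt-BirchSwinnertonDyer-19624, REST‴): GLOBAL MINIMALITY of the
# two (D)-witness models IN THE KERNEL — the instance binder `[W.IsGloballyMinimal]` of the registered rungs R3 ∕ R4 (D1) and R5 (D2) made a
# theorem (R1 ∕ R2's models 5015b1 ∕ 5595f1 already have `isGloballyMinimal_5015b1` p449825 ∕ `isGloballyMinimal_5595f1` p453656) (cell `bsd-stepL`, owner seat `bsd-stepL-rest-p2` g6; `--supports stmt-BirchSwinnertonDyer-19624`; THEOREMS ONLY; Theses-FREE)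

The rungs of crux 19624 state `P2OpenInputOnTreeAt W 5`, whose definition needs the instances `[W.IsElliptic] [W.IsGloballyMinimal]` on the literal
model `W = (⟨a₁,…,a₆⟩ : WeierstrassCurve ℤ).baseChange ℚ`; the rung files prove ellipticity (`isElliptic_D1`, `isElliptic_D2`, …) but so far took global
minimality as an instance BINDER («as in R1/R2», p534559). Here it is PROVED for D1 and D2 by Kraus' criterion on the complete factorisation
of `|Δ|` (every exponent `< 12`; tree `isGloballyMinimal_of_krausCriterion₃_factored`, Silverman VII.1 Rem. 1.1):
`|Δ(D1)| = 5³·11⁶·47·197⁶`, `|Δ(D2)| = 2⁶·5·127·359⁶`. So a consumer of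
`Rest3Rungs.stub_rung_shaDiv_D1_hesse` etc. can supply BOTH instances from the kernel (`haveI := isGloballyMinimal_D1`): after this file the
ONLY hypotheses of the R4 ∕ R5 rungs that are not published named facts or kernel theorems are the two analytic data `r_an = 1`, `#Ш_an = 25`
(R1 ∕ R2: the Heegner datum and `[NeZero (conductorNorm ℤ)]`, their minimality being in the tree already).

HONEST FRAMING: THEOREMS ONLY (no definition, no named fact, no `sorry`); two explicit curves; nothing booked; no census word moves (T7).
References: [SilvermanAEC2009] VII.1 Remark 1.1; [Kraus1989] Prop. 1–2; [Cremona1997] Table 1 (235a1, 635b1).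
-/

-- the Theorems namespace of this sub repeats the summit name by design (D-0017 nested layout)
set_option linter.dupNamespace false
set_option autoImplicit false

noncomputable section

open scoped Classical

open WeierstrassCurve Literature.NumberTheory.EllipticCurves
  Literature.NumberTheory.EllipticCurves.Rank1Residual.X11RankOneCertificates
  Summit.BirchSwinnertonDyer.BirchSwinnertonDyer.Rank1Residual.IntModel
  Summit.BirchSwinnertonDyer.Rank1Residual.Supersingular

namespace Summit.BirchSwinnertonDyer.BirchSwinnertonDyer.Theorems

/-- **The literal model of D1 (235a1 ⊗ (−2167), the (D)-witness of rungs R3 ∕ R4) is globally minimal**: `|Δ| = 5^3·11^6·47·197^6` (complete factorisation, kernel), every exponent `< 12`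
(Kraus ∕ Silverman VII.1 Rem. 1.1). [cite: SilvermanAEC2009, VII.1 Remark 1.1] [cite: Kraus1989, Prop. 1 and Prop. 2] -/
theorem isGloballyMinimal_D1 : ((⟨1, 0, 0, -23577276, -23098167619⟩ : WeierstrassCurve ℤ).baseChange ℚ).IsGloballyMinimal := by
  have h : (⟨1, 0, 0, -23577276, -23098167619⟩ : WeierstrassCurve ℤ).baseChange ℚ = (⟨1, 0, 0, -23577276, -23098167619⟩ : WeierstrassCurve ℚ) := by
    show (⟨_, _, _, _, _⟩ : WeierstrassCurve ℤ).map (algebraMap ℤ ℚ) = _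
    ext <;> simp [WeierstrassCurve.map]
  rw [h]
  exact isGloballyMinimal_of_krausCriterion₃_factored 1 0 0 (-23577276) (-23098167619)
    [(5, 3), (11, 6), (47, 1), (197, 6)] (by decide +kernel)
    (by intro qe hqe; simp only [List.mem_cons, List.not_mem_nil, or_false] at hqe
        rcases hqe with rfl | rfl | rfl | rfl <;> norm_num)
    (by intro qe hqe; simp only [List.mem_cons, List.not_mem_nil, or_false] at hqe
        rcases hqe with rfl | rfl | rfl | rfl <;> exact Or.inl (by decide +kernel))

/-- **The literal model of D2 (635b1 ⊗ (−2872), the (D)-witness of rung R5) is globally minimal**: `|Δ| = 2^6·5·127·359^6` (complete factorisation, kernel), every exponent `< 12`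
(Kraus ∕ Silverman VII.1 Rem. 1.1). [cite: SilvermanAEC2009, VII.1 Remark 1.1] [cite: Kraus1989, Prop. 1 and Prop. 2] -/
theorem isGloballyMinimal_D2 : ((⟨0, 1, 0, -5327081, -4755412951⟩ : WeierstrassCurve ℤ).baseChange ℚ).IsGloballyMinimal := by
  have h : (⟨0, 1, 0, -5327081, -4755412951⟩ : WeierstrassCurve ℤ).baseChange ℚ = (⟨0, 1, 0, -5327081, -4755412951⟩ : WeierstrassCurve ℚ) := by
    show (⟨_, _, _, _, _⟩ : WeierstrassCurve ℤ).map (algebraMap ℤ ℚ) = _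
    ext <;> simp [WeierstrassCurve.map]
  rw [h]
  exact isGloballyMinimal_of_krausCriterion₃_factored 0 1 0 (-5327081) (-4755412951)
    [(2, 6), (5, 1), (127, 1), (359, 6)] (by decide +kernel)
    (by intro qe hqe; simp only [List.mem_cons, List.not_mem_nil, or_false] at hqe
        rcases hqe with rfl | rfl | rfl | rfl <;> norm_num)
    (by intro qe hqe; simp only [List.mem_cons, List.not_mem_nil, or_false] at hqe
        rcases hqe with rfl | rfl | rfl | rfl <;> exact Or.inl (by decide +kernel))

end Summit.BirchSwinnertonDyer.BirchSwinnertonDyer.Theorems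

end
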